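import Summits.SmoothPoincare4.SmoothPoincare4.Theorems.SullivanDualTargetOfCruxes
import Summits.SmoothPoincare4.SmoothPoincare4.Theorems.SullivanDualWitnessChargeOfPencilFacts
import Summits.SmoothPoincare4.SmoothPoincare4.Theorems.SullivanDualTargetStubCroftonTaming

/-!
# SmoothPoincare4 / SullivanDual — crux `Target` (stmt-SmoothPoincare4-7823)
# LINE `crofton-pencil-laminar-charge` — SKELETON v5 (lead c7, 2026-08-17): SUPERSESSION FORM

v1 = planner crux-plan (4 stubs); v2 = a1's reshape of Stubs 1/2 (intercept maps, parametric
Crofton integral); v3 = Stub 1 `stub_croftonTaming` PROVED (p128497); v4 = c5: far-field / energy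
helpers landed (p129889 p129800 p129875 p131128 p131097), literature audit: Stub 2 `stub_dualPlane`
(bounded lines ⇒ pencil data) is a J-curve MODULI PACKAGE (Hummel compactness + HLS/Wendl automatic
transversality + McDuff positivity + an unwritten assembly; XL, `promote-stub`), Stub 3
`stub_linesOrCurve` rests on the almost-complex Duval theorem (printed only as a remark), Stub 4
`stub_hyperbolicEnd` = crux stmt-SmoothPoincare4-7825 verbatim.

**v5 (this file).** On 2026-08-17 the planner's route-choice repair PROMOTED the J-curve package
that Stubs 2–3 needed into route items — the crux `PencilLocalFamily` (stmt-SmoothPoincare4-16772,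
Wendl 2018 Prop. 2.53: local family of Gromov's pencil of `J`-planes at a member, existence and
universality) and the listed debt `LimitOfEmbeddedPlanes` (stmt-SmoothPoincare4-16809, McDuff 1991
§4) — and the glue `WitnessChargeOfPencilFacts` (16810: `PencilLocalFamily → LimitOfEmbeddedPlanes →
WitnessCharge`, ≈ 90 files of line `Sketch` of crux 7824: flat-end confinement, canonical
parametrisations, Brody–Zalcman dichotomy, continuity method, covering argument, EXACT TAMING FORM
OF A COMPLETE PENCIL, bubble confinement) is CLOSED, as is `TargetOfCruxes` (7831:
`WitnessCharge → HyperbolicEnd → Target`). That chain is this line's dichotomy in direction-`0`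
form: "complete pencil ⇒ closed taming form ⇒ no witness" is Stubs 1+2 (Crofton over the dual
plane), "incomplete pencil ⇒ bounded entire curve in the core" is Stub 3, and both consume the `J`
of `HyperbolicEnd` (Stub 4). Following the line card's own contingency ("S2 … promote to a route
crux if it resists — it is the honest residue of every J-curve line on this route"), v5 REPLACES
the unlanded black boxes `stub_dualPlane` / `stub_linesOrCurve` by the two promoted items, stated
BY NAME, and composes through the landed spine:

* `stub_hyperbolicEnd` — UNCHANGED (v1-registered, byte-identical): crux 7825 verbatim;
* `stub_pencilLocalFamily` — NEW: the route crux `PencilLocalFamily` (item 16772) by name;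
* `stub_limitOfEmbeddedPlanes` — NEW: the route item `LimitOfEmbeddedPlanes` (item 16809) by name;
* `helper_targetOfRouteLeaves` — PROVED here (pure logic over the closed items 16810 + 7831; landed
  as `Theorems/SullivanDualTargetRouteLeaves.lean`, which also carries the rewired deciding theorem
  `closes_rewired : HyperbolicEnd → PencilLocalFamily → LimitOfEmbeddedPlanes →
  GromovRecognitionRelEnd → SmoothPoincare4` and `HyperbolicEnd ↔ Target ↔ SmoothPoincare4` modulo
  the three known-theorem debts);
* `Target_of : Theses.SullivanDual.Target` — the crux BY NAME from the three stubs.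

So the line is CLOSED MODULO THREE REGISTERED STUBS EACH OF WHICH IS A ROUTE ITEM WITH ITS OWN
SEAT (7825 conjecture-grade = SPC4 on this route; 16772 XL known theorem; 16809 L known theorem):
nothing in it is lead- or worker-sized any more (`wave: none — 0 delegable stubs`), exactly the
saturated state in which line `Sketch` (1 stub = item 0518) was handed back by c4. Retired from the
registered stub list: `stub_dualPlane`, `stub_linesOrCurve` (never refuted; superseded). Kept for
the record: `stub_croftonTaming` (Stub 1, PROVED, re-exported below) — the unconditional
mathematics this line contributed (with the ten far-field / energy helpers of a1/c5).

Disproof used: none exists for this crux (no `Cruxes/Target/Disproof.lean`, no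
`Theorems/Target/Negative/`; checked 2026-08-17T02:00Z).

References: M. Gromov, Invent. Math. 82 (1985) §2.4.A–A′; C. Wendl, *Holomorphic Curves in Low
Dimensions*, LNM 2216 (2018) Prop. 2.53; D. McDuff, *The local behaviour of holomorphic curves in
almost complex 4-manifolds*, JDG 34 (1991) §4; D. Sullivan, Invent. Math. 36 (1976) Thm I.7.
-/

noncomputable section

-- the prescribed namespace `Summit.<P>.<Sub>.…` duplicates `SmoothPoincare4` (P = Sub)
set_option linter.dupNamespace false

open scoped Manifold ContDiff Topology
open Literature.Geometry.Kaehler Literature.Geometry.Symplectic Literature.Topology.FourManifolds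

namespace Summit.SmoothPoincare4.SmoothPoincare4.Cruxes.Target.CroftonPencilLaminarCharge

/-! ## Stub 1 — landed (record) -/

/-- **Stub 1 — relative CROFTON TAMING (PROVED, a1: `Theorems/SullivanDualTargetStubCroftonTaming.lean`
p128497 over p127984 p128087 p128272 p128278).** Pencil data (Q1)–(Q4) for ANY endomorphism field
`J` ⇒ a smooth CLOSED `2`-form with `sf(v, Jv) > 0`. Not used by the v5 composition (the spine's
exact taming form of a complete pencil plays its part inside item 16810); re-exported as the line's
unconditional contribution. [cite: Gromov1985, §2.4.A′] -/
theorem stub_croftonTaming :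
    ∀ (S : HomotopySphere 4) (p : S.carrier)
      (J : ∀ x : punctured p, TangentSpace (𝓡 4) x →L[ℝ] TangentSpace (𝓡 4) x)
      (Φ : Bool → ℂ → punctured p → ℂ) (R₀ : ℝ),
      (∀ σ, ContMDiff (𝓘(ℝ, ℂ).prod (𝓡 4)) 𝓘(ℝ, ℂ) ∞ (Function.uncurry (Φ σ))) →
      (∀ σ (a : ℂ) (x : punctured p) (v : TangentSpace (𝓡 4) x),
        mfderiv (𝓡 4) 𝓘(ℝ, ℂ) (Φ σ a) x v ≠ 0 →
        0 < (mfderiv (𝓡 4) 𝓘(ℝ, ℂ) (Φ σ a) x v).re * (mfderiv (𝓡 4) 𝓘(ℝ, ℂ) (Φ σ a) x (J x v)).im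
            - (mfderiv (𝓡 4) 𝓘(ℝ, ℂ) (Φ σ a) x v).im * (mfderiv (𝓡 4) 𝓘(ℝ, ℂ) (Φ σ a) x (J x v)).re) →
      (∀ σ (x : punctured p) (v : TangentSpace (𝓡 4) x) (a a' : ℂ), v ≠ 0 →
        mfderiv (𝓡 4) 𝓘(ℝ, ℂ) (Φ σ a) x v = 0 → mfderiv (𝓡 4) 𝓘(ℝ, ℂ) (Φ σ a') x v = 0 → a = a') →
      (∀ x : punctured p, ∃ (σ : Bool) (a : ℂ), ‖a‖ ≤ 1 ∧ ‖Φ σ a x‖ ≤ R₀) →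
      ∃ sf : MForm (𝓡 4) (punctured p) ℝ 2, IsSmoothForm sf ∧ IsClosedForm sf ∧
        ∀ (x : punctured p) (v : TangentSpace (𝓡 4) x), v ≠ 0 → 0 < sf x ![v, J x v] :=
  Summit.SmoothPoincare4.SmoothPoincare4.Theorems.Target.CroftonPencil.stub_croftonTaming

/-! ## The three registered stubs of v5 — each a route item verbatim / by name -/

/-- **Stub 4 — `HyperbolicEnd`, VERBATIM the route crux stmt-SmoothPoincare4-7825** (unchanged
since v1; closes when `HyperbolicEnd_holds` lands; implied by SPC4:
`Theorems/SullivanDualHyperbolicEndSPC4Case.lean`; conversely SPC4-complete on this route: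
`Theorems/SullivanDualTargetRouteLeaves.lean`, `hyperbolicEnd_iff_smoothPoincare4`).
[cite: Gromov1985, §2.4] -/
theorem stub_hyperbolicEnd :
    ∀ (S : Literature.Topology.FourManifolds.HomotopySphere 4) (p : S.carrier), ∃ (J : ∀ x : ↥(Literature.Geometry.Symplectic.punctured p), TangentSpace (𝓡 4) x →L[ℝ] TangentSpace (𝓡 4) x) (ε' : ℝ), 0 < ε' ∧ Metric.closedBall (extChartAt (𝓡 4) p p) ε' ⊆ (extChartAt (𝓡 4) p).target ∧ (∀ (x : ↥(Literature.Geometry.Symplectic.punctured p)) (v : TangentSpace (𝓡 4) x), J x (J x v) = -v) ∧ (∀ x₀ : ↥(Literature.Geometry.Symplectic.punctured p), ContMDiffAt (𝓡 4) 𝓘(ℝ, EuclideanSpace ℝ (Fin 4) →L[ℝ] EuclideanSpace ℝ (Fin 4)) ∞ (inTangentCoordinates (𝓡 4) (𝓡 4) (id : ↥(Literature.Geometry.Symplectic.punctured p) → ↥(Literature.Geometry.Symplectic.punctured p)) id (fun x => J x) x₀) x₀) ∧ (∀ x : ↥(Literature.Geometry.Symplectic.punctured p), Literature.Geometry.Symplectic.InPuncturedChartBall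 p ε' x → ∀ (v : TangentSpace (𝓡 4) x) (b : EuclideanSpace ℝ (Fin 4)), inner ℝ (fderiv ℝ Literature.Geometry.Symplectic.inversion (extChartAt (𝓡 4) p x.1 - extChartAt (𝓡 4) p p) (mfderiv (𝓡 4) 𝓘(ℝ, EuclideanSpace ℝ (Fin 4)) (fun z : ↥(Literature.Geometry.Symplectic.punctured p) => extChartAt (𝓡 4) p z.1) x (J x v))) b = Literature.Geometry.Symplectic.stdSymplecticForm (fderiv ℝ Literature.Geometry.Symplectic.inversion (extChartAt (𝓡 4) p x.1 - extChartAt (𝓡 4) p p) (mfderiv (𝓡 4) 𝓘(ℝ, EuclideanSpace ℝ (Fin 4)) (fun z : ↥(Literature.Geometry.Symplectic.punctured p) => extChartAt (𝓡 4) p z.1) x v)) b) ∧ ∀ ε : ℝ, 0 < ε → ε < ε' → ¬ ∃ u : ℂ → ↥(Literature.Geometry.Symplectic.punctured p), (ContMDiff 𝓘(ℝ, ℂ) (𝓡 4) ∞ u ∧ (∃ z z' : ℂ, u z ≠ u z') ∧ (∀ z ζ : ℂ, mfderiv 𝓘(ℝ, ℂ) (𝓡 4) u z (Complex.I * ζ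 : ℂ) = J (u z) (mfderiv 𝓘(ℝ, ℂ) (𝓡 4) u z (ζ : ℂ))) ∧ (∀ z : ℂ, ¬ Literature.Geometry.Symplectic.InPuncturedChartBall p ε (u z))) := by
  sorry

/-- **Stub 5 — `PencilLocalFamily`, the route crux stmt-SmoothPoincare4-16772 BY NAME** (the
local family of Gromov's pencil of `J`-planes at a member of a punctured homotopy `4`-sphere with a
standard flat end — existence AND universality; Wendl 2018 Prop. 2.53 with m = 1; definitionally
the Literature named fact `jPlanePencil_localFamily_homotopySphere`). Known theorem, XL formally
(no Fredholm / implicit-function theory for `∂̄_J` in Mathlib); replaces v1–v4's `stub_dualPlane`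
(the regularity / smooth-dependence half BB3 of its moduli package). [cite: Wendl2018, Prop. 2.53] -/
theorem stub_pencilLocalFamily :
    Summit.SmoothPoincare4.SmoothPoincare4.Theses.SullivanDual.PencilLocalFamily := by
  sorry

/-- **Stub 6 — `LimitOfEmbeddedPlanes`, the route item stmt-SmoothPoincare4-16809 BY NAME**
(McDuff 1991 §4: a compact-uniform limit of `J`-holomorphic injective immersions `ℂ → V` which is
an injective immersion on an annulus, mapped disjointly from the inner disc, is an injective
immersion on the disc; definitionally `jHolomorphicLimitOfEmbedded_isEmbedded`; reduced in
`Theorems/SullivanDualWitnessChargeReductionV9.lean` to the flat cusp theorem). Known theorem,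
L-sized; replaces v1–v4's `stub_linesOrCurve` / the compactness half BB1–BB2 of `stub_dualPlane`.
[cite: McDuff1991LocalBehaviour, §4] -/
theorem stub_limitOfEmbeddedPlanes :
    Summit.SmoothPoincare4.SmoothPoincare4.Theses.SullivanDual.LimitOfEmbeddedPlanes := by
  sorry

/-! ## Glue (proved) and composition -/

/-- **`Target` from the route's three open leaves** — pure logic over the CLOSED items
`WitnessChargeOfPencilFacts` (16810, `witnessChargeOfPencilFacts_proof`) and `TargetOfCruxes`
(7831, `targetOfCruxes_proof`). Landed verbatim as
`Summit.SmoothPoincare4.SmoothPoincare4.Theorems.SullivanDual.helper_targetOfRouteLeaves`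
(`Theorems/SullivanDualTargetRouteLeaves.lean`). -/
theorem helper_targetOfRouteLeaves :
    Summit.SmoothPoincare4.SmoothPoincare4.Theses.SullivanDual.HyperbolicEnd → Summit.SmoothPoincare4.SmoothPoincare4.Theses.SullivanDual.PencilLocalFamily → Summit.SmoothPoincare4.SmoothPoincare4.Theses.SullivanDual.LimitOfEmbeddedPlanes → Summit.SmoothPoincare4.SmoothPoincare4.Theses.SullivanDual.Target :=
  fun hHE hP hL =>
    Summit.SmoothPoincare4.SmoothPoincare4.Theorems.targetOfCruxes_proof
      (Summit.SmoothPoincare4.SmoothPoincare4.Theorems.witnessChargeOfPencilFacts_proof hP hL) hHE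

/-- **The line closes the crux BY NAME (the registered skeleton theorem, v5)**: `Target` of route
SullivanDual from the three stubs `stub_hyperbolicEnd` (= 7825), `stub_pencilLocalFamily`
(= 16772), `stub_limitOfEmbeddedPlanes` (= 16809) — the only `sorry`s of this file are inside
those — through `helper_targetOfRouteLeaves`. -/
theorem Target_of : Summit.SmoothPoincare4.SmoothPoincare4.Theses.SullivanDual.Target :=
  helper_targetOfRouteLeaves stub_hyperbolicEnd stub_pencilLocalFamily stub_limitOfEmbeddedPlanes

end Summit.SmoothPoincare4.SmoothPoincare4.Cruxes.Target.CroftonPencilLaminarCharge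

end
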